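import Summits.MatrixMultiplication.MatrixMultiplication.Theorems.ObstructionDescentUniversalOccurrenceTwoRectangleFourOdd
import Summits.MatrixMultiplication.MatrixMultiplication.Theorems.ObstructionDescentUniversalOccurrenceTwoRectangleEvenTypes
import Summits.MatrixMultiplication.MatrixMultiplication.Theorems.ObstructionDescentUniversalOccurrenceTwoRectangleThreeRowsFourFour

set_option linter.dupNamespace false
set_option autoImplicit false

/-!
# Universal occurrence — the two-rectangular sector `((2^N),(2^N),ν)`: the citable state after generation 44
(decomp-mm · lens 3 · gen 44, K32-G)

Route `route-MatrixMultiplication-ObstructionDescent` (sub-problem `MatrixMultiplication`, `ω(ℂ) = 2`); SUPPORT for the crux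
`NoOccurrenceObstruction` (`P_O`, item `stmt-MatrixMultiplication-29040`).  Two WRAPPERS in sorted-parts form, no `def`, no `sorry`:

* `occurs_unitTensor_twoRectangle_hookDominoTypes` — the all-`j` theorem `occurs_unitTensor_twoRectangle_fourOdd`
  (`…TwoRectangleFourOdd`) restated: for `N ≥ 4`, `m ≥ N + 2`, `λ⁽⁰⁾ = λ⁽¹⁾ = (2^N)` and `λ⁽²⁾.sortedParts = [a, b, 1, 1]` with
  `b` odd, the `((2^N),(2^N),(a,b,1,1))`-isotypic piece of `⟨m⟩^{⊗2N}` is `≠ 0` on the orbit closure (`b` odd is necessary: by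
  `s_{(N,N)} ∗ s_{(N,N)} = Σ_{≤ 4 parts, all even or all odd} s_λ` a mixed-parity `ν` has Kronecker coefficient `0`); supersedes
  `occurs_unitTensor_twoRectangle_fourOddTypes` (`b ≤ 5`).
* `occurs_unitTensor_twoRectangle_sector` — ONE statement for the `P_O` dossier collecting everything kernel-checked in the sector:
  for `N ≥ 4`, `m ≥ N + 2` and `λ⁽²⁾.sortedParts = a :: rest` with `rest` EITHER even with `rest.tail ⊆ {2}` and `|rest| ≤ 3`
  (`…TwoRectangleEvenTypes`, there for all `m ≥ N`) OR `rest = [4,4]` (`…ThreeRowsFourFour`, `m ≥ N`) OR `rest = [b,1,1]`, `b` odd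
  (this generation, `m ≥ N + 2` — sharp), the type occurs for `⟨m⟩`.

[cite: BurgisserIkenmeyer2011, Prop. 3.4, Thm. 4.4] [cite: BurgisserIkenmeyer2017, §5, Thm. 5.9 (proof of (2))]
-/

noncomputable section

open scoped BigOperators

namespace Summit.MatrixMultiplication.MatrixMultiplication.Theorems.ObstructionCalculus

open Literature.Computability.AlgebraicComplexity
open Literature.NumberTheory.DiophantineGeometry

/-- **Every type `((2^N),(2^N),(a,b,1,1))` with `b` odd, `N ≥ 4`, occurs for `⟨m⟩`, all `m ≥ N + 2`.**
[cite: BurgisserIkenmeyer2011, Thm. 4.4] [cite: BurgisserIkenmeyer2017, Thm. 5.9 (proof of (2))] -/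
theorem occurs_unitTensor_twoRectangle_hookDominoTypes {N m a b : ℕ} (hN : 4 ≤ N) (hNm : N + 2 ≤ m)
    {lam : Fin 3 → Nat.Partition (N * 2)} (h0 : lam 0 = Nat.Partition.rectangle N 2)
    (h1 : lam 1 = Nat.Partition.rectangle N 2) (h2 : (lam 2).sortedParts = [a, b, 1, 1]) (hb : b % 2 = 1) :
    isotypicSum₁ (lam 0) (isotypicSum₂ (lam 1) (isotypicSum₃ (lam 2)
      (kroneckerPow (unitTensor ℂ m) (N * 2)))) ≠ 0 := by
  have hsum : a + (b + (1 + (1 + 0))) = N * 2 := by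
    have h := (lam 2).sum_sortedParts
    rwa [h2, List.sum_cons, List.sum_cons, List.sum_cons, List.sum_cons, List.sum_nil] at h
  have hsort : b ≤ a := by
    have h := List.sortedGE_iff_pairwise.mp (lam 2).sortedGE_sortedParts
    rw [h2, List.pairwise_cons] at h
    exact h.1 b (by simp)
  obtain ⟨j, rfl⟩ : ∃ j, b = 2 * j + 1 := ⟨b / 2, by omega⟩
  obtain rfl : a = 2 * N - (2 * j + 3) := by omega
  exact occurs_unitTensor_twoRectangle_fourOdd hN (by omega) hNm h0 h1 h2

/-- **The two-rectangular sector, state of generation 44**: every type `((2^N),(2^N),ν)` with `ν` even, `≤ 4` rows and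
`ν₃ ≤ 2`, or `ν = (2N-8,4,4)`, or `ν = (a,b,1,1)` with `b` odd occurs for `⟨m⟩`, all `m ≥ N + 2` (`N ≥ 4`).
[cite: BurgisserIkenmeyer2011, Thm. 4.4] [cite: BurgisserIkenmeyer2017, Thm. 5.9 (proof of (2))] -/
theorem occurs_unitTensor_twoRectangle_sector {N m : ℕ} (hN : 4 ≤ N) (hNm : N + 2 ≤ m)
    {lam : Fin 3 → Nat.Partition (N * 2)} (h0 : lam 0 = Nat.Partition.rectangle N 2)
    (h1 : lam 1 = Nat.Partition.rectangle N 2) {a : ℕ} {rest : List ℕ} (h2 : (lam 2).sortedParts = a :: rest)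
    (hrest : ((∀ x ∈ rest, Even x) ∧ (∀ x ∈ rest.tail, x = 2) ∧ rest.length ≤ 3) ∨ rest = [4, 4] ∨
      (∃ b, rest = [b, 1, 1] ∧ b % 2 = 1)) :
    isotypicSum₁ (lam 0) (isotypicSum₂ (lam 1) (isotypicSum₃ (lam 2)
      (kroneckerPow (unitTensor ℂ m) (N * 2)))) ≠ 0 := by
  rcases hrest with ⟨heven, htail, hlen⟩ | rfl | ⟨b, rfl, hb⟩
  · exact occurs_unitTensor_twoRectangle_evenTypes (by omega) h0 h1 h2 heven htail hlen
  · have hsum : a + (4 + (4 + 0)) = N * 2 := by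
      have h := (lam 2).sum_sortedParts
      rwa [h2, List.sum_cons, List.sum_cons, List.sum_cons, List.sum_nil] at h
    have hsort : 4 ≤ a := by
      have h := List.sortedGE_iff_pairwise.mp (lam 2).sortedGE_sortedParts
      rw [h2, List.pairwise_cons] at h
      exact h.1 4 (by simp)
    obtain rfl : a = 2 * N - 8 := by omega
    exact occurs_unitTensor_twoRectangle_threeRowsFour (by omega) (by omega) h0 h1 h2
  · exact occurs_unitTensor_twoRectangle_hookDominoTypes hN hNm h0 h1 h2 hb

end Summit.MatrixMultiplication.MatrixMultiplication.Theorems.ObstructionCalculus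

end
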